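import Literature.NumberTheory.LFunctions.DedekindZetaThetaProofs
import Mathlib.Analysis.Complex.LocallyUniformLimit
import Mathlib.Analysis.Normed.Group.Tannery
import HarnessLib

/-!
# Theta series of a Euclidean lattice (with a shift): convergence, holomorphy, behaviour at `i∞`

Topic `Literature/Algebra/EuclideanLattices`. For a full lattice `Γ` in a Euclidean space `V`, a
vector `u ∈ V` and `τ` in the upper half plane, the **theta series of the coset `Γ + u`** is
`Θ_{Γ+u}(τ) = ∑_{x ∈ Γ} e^{πiτ ‖x + u‖²}` (Conway–Sloane, *Sphere Packings, Lattices and Groups*,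
Ch. 2 §2.3 (31)–(32): `Θ_Λ(z) = ∑_{x ∈ Λ} q^{x·x}`, `q = e^{πiz}`, "a holomorphic function of
`z` for `Im(z) > 0`", and the theta series of a translate `Λ + u`; Ch. 4 §4.1 (14), (19):
Jacobi's imaginary transformation and "Jacobi's formula for the theta series of the dual
lattice" `Θ_{Λ*}(z) = (det Λ)^{1/2} (i/z)^{n/2} Θ_Λ(-1/z)`; Serre, *A Course in Arithmetic*,
Ch. VII §6; Elkies 1995, where
`Θ_{L + w/2}` for a characteristic vector `w` controls `Θ_L` at the cusp `1` of `Γ_θ`).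
Everything here is proved; no definition and no named fact is introduced — the series is written
out as `∑' x : Γ, cexp (π I τ ‖x + u‖²)` throughout (it is the input of the theta inversion
formula `LatticeThetaInversion.lean` and of Elkies' theorem).

* `norm_cexp_pi_I_mul` — `|e^{πiτr}| = e^{-π (Im τ) r}`;
* `exp_neg_pi_mul_norm_add_sq_le` — Gaussian decay of `e^{-πt‖x+u‖²}` against `(1 + ‖x‖)^{-b}`;
* `summable_cexp_pi_I_mul_norm_add_sq` — absolute convergence for `Im τ > 0`
  (Conway–Sloane Ch. 2 §2.3: "a holomorphic function of `z` for `Im z > 0`");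
* `differentiableOn_tsum_cexp_pi_I_mul_norm_add_sq` — holomorphy on the upper half plane;
* `norm_tsum_cexp_pi_I_mul_norm_add_sq_le` — `|Θ_{Γ+u}(τ)| ≤ e^{-π(Im τ - 1) m} Θ_{Γ+u}(i)` when
  `‖x + u‖² ≥ m` on `Γ` and `Im τ ≥ 1` (the size of `Θ_{Γ+u}` at `i∞` is governed by the minimal
  norm of the coset, Elkies 1995);
* `tendsto_tsum_cexp_pi_I_mul_norm_sq` — `Θ_Γ(τ) → 1` as `Im τ → ∞`;
* `tsum_cexp_pi_I_mul_norm_sq_add_two` — `Θ_Γ(τ + 2) = Θ_Γ(τ)` for an integral lattice;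
* `fourier_cexp_pi_I_mul_norm_add_sq` —
  `𝓕[e^{πiτ‖·+u‖²}](w) = e^{2πi⟨u,w⟩} (i/τ)^{n/2} e^{-πi‖w‖²/τ}`;
* `tsum_cexp_pi_I_mul_norm_add_sq_eq` — **theta inversion with a shift** (Poisson summation over
  `Γ`, from the tree's
  `Literature.NumberTheory.LFunctions.Fourier.tsum_eq_tsum_fourier_of_rpow_decay`):
  `∑_{x ∈ Γ} e^{πiτ‖x+u‖²} = vol(V/Γ)⁻¹ (i/τ)^{n/2} ∑_{y ∈ Γ*} e^{2πi⟨u,y⟩} e^{-πi‖y‖²/τ}`, and its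
  case `u = 0`, `tsum_cexp_pi_I_mul_norm_sq_eq`: `Θ_Γ(τ) = vol(V/Γ)⁻¹ (i/τ)^{n/2} Θ_{Γ*}(-1/τ)`
  (Conway–Sloane Ch. 4 (19) applied to `Λ = Γ*`).

## References

* J. H. Conway, N. J. A. Sloane, *Sphere Packings, Lattices and Groups*, 3rd ed. (Springer 1999),
  Ch. 2 §2.3 (31)–(32) (p. 45), Ch. 4 §4.1 (14)–(19) (p. 103). [ConwaySloane1999]
* J.-P. Serre, *A Course in Arithmetic* (GTM 7, 1973), Ch. VII §6 (theta functions of lattices).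
  [Serre1973]
* N. D. Elkies, *A characterization of the `ℤⁿ` lattice*, Math. Res. Lett. 2 (1995) 321–326.
  [Elkies1995]
-/

noncomputable section

open Complex Filter Topology
open scoped Real

namespace Literature.Algebra.EuclideanLattices

/-! ### The summand `e^{πiτ r}` -/

/-- `Re(πiτ r) = -π (Im τ) r` for real `r`. [folklore] -/
theorem re_pi_I_mul (τ : ℂ) (r : ℝ) : ((π : ℂ) * I * τ * (r : ℂ)).re = -π * τ.im * r := by
  simp [mul_re, mul_im, I_re, I_im, ofReal_re, ofReal_im]

/-- `|e^{πiτ r}| = e^{-π (Im τ) r}` for real `r`. [folklore] -/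
theorem norm_cexp_pi_I_mul (τ : ℂ) (r : ℝ) :
    ‖cexp ((π : ℂ) * I * τ * (r : ℂ))‖ = Real.exp (-π * τ.im * r) := by
  rw [norm_exp, re_pi_I_mul]

/-- Monotonicity in `Im τ`: for `r ≥ 0` and `t ≤ Im τ`, `|e^{πiτ r}| ≤ e^{-π t r}`. [folklore] -/
theorem norm_cexp_pi_I_mul_le {τ : ℂ} {t r : ℝ} (ht : t ≤ τ.im) (hr : 0 ≤ r) :
    ‖cexp ((π : ℂ) * I * τ * (r : ℂ))‖ ≤ Real.exp (-π * t * r) := by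
  rw [norm_cexp_pi_I_mul, Real.exp_le_exp]
  have := Real.pi_pos
  nlinarith [mul_nonneg (mul_nonneg Real.pi_pos.le (sub_nonneg.mpr ht)) hr]

section Decay

variable {V : Type*} [NormedAddCommGroup V]

/-- **Gaussian decay with a shift**: for `t > 0`, `b ≥ 0`,
`e^{-πt‖x+u‖²} ≤ e^{b²/(4πt)} (1 + ‖u‖)^b (1 + ‖x‖)^{-b}` (complete the square,
the tree's `Literature.NumberTheory.LFunctions.NumberField.exp_neg_mul_sq_le`, and
`1 + ‖x‖ ≤ (1 + ‖u‖)(1 + ‖x + u‖)`).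
[folklore] -/
theorem exp_neg_pi_mul_norm_add_sq_le {t b : ℝ} (ht : 0 < t) (hb : 0 ≤ b) (u x : V) :
    Real.exp (-π * t * ‖x + u‖ ^ 2) ≤
      Real.exp (b ^ 2 / (4 * (π * t))) * (1 + ‖u‖) ^ b * (1 + ‖x‖) ^ (-b) := by
  have hπt : 0 < π * t := mul_pos Real.pi_pos ht
  have h1 := Literature.NumberTheory.LFunctions.NumberField.exp_neg_mul_sq_le hπt hb
    (norm_nonneg (x + u))
  rw [show -π * t * ‖x + u‖ ^ 2 = -(π * t) * ‖x + u‖ ^ 2 by ring]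
  refine h1.trans ?_
  rw [mul_assoc]
  gcongr
  -- `(1 + ‖x + u‖)^{-b} ≤ (1 + ‖u‖)^b (1 + ‖x‖)^{-b}`
  have hxu : 1 + ‖x‖ ≤ (1 + ‖u‖) * (1 + ‖x + u‖) := by
    have : ‖x‖ ≤ ‖x + u‖ + ‖u‖ := by
      calc ‖x‖ = ‖(x + u) - u‖ := by rw [add_sub_cancel_right]
        _ ≤ ‖x + u‖ + ‖u‖ := norm_sub_le _ _
    nlinarith [norm_nonneg (x + u), norm_nonneg u]
  have hpos : 0 < 1 + ‖u‖ := by positivity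
  have hdiv : (1 + ‖x‖) / (1 + ‖u‖) ≤ 1 + ‖x + u‖ := by
    rw [div_le_iff₀ hpos]; linarith
  calc (1 + ‖x + u‖) ^ (-b) ≤ ((1 + ‖x‖) / (1 + ‖u‖)) ^ (-b) :=
        Real.rpow_le_rpow_of_nonpos (by positivity) hdiv (by linarith)
    _ = (1 + ‖u‖) ^ b * (1 + ‖x‖) ^ (-b) := by
        rw [Real.div_rpow (by positivity) (by positivity), Real.rpow_neg hpos.le, div_inv_eq_mul,
          mul_comm]

/-- **Decay of the theta summand**: for `0 < t ≤ Im τ` and `b ≥ 0`,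
`|e^{πiτ‖x+u‖²}| ≤ e^{b²/(4πt)} (1 + ‖u‖)^b (1 + ‖x‖)^{-b}`. [folklore] -/
theorem norm_cexp_pi_I_mul_norm_add_sq_le {τ : ℂ} {t b : ℝ} (ht : 0 < t) (htτ : t ≤ τ.im)
    (hb : 0 ≤ b) (u x : V) :
    ‖cexp ((π : ℂ) * I * τ * ((‖x + u‖ ^ 2 : ℝ) : ℂ))‖ ≤
      Real.exp (b ^ 2 / (4 * (π * t))) * (1 + ‖u‖) ^ b * (1 + ‖x‖) ^ (-b) :=
  (norm_cexp_pi_I_mul_le htτ (sq_nonneg _)).trans (exp_neg_pi_mul_norm_add_sq_le ht hb u x)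

end Decay

/-! ### The theta series of `Γ + u` -/

section Lattice

variable {V : Type*} [NormedAddCommGroup V] [InnerProductSpace ℝ V] [FiniteDimensional ℝ V]
  (Γ : Submodule ℤ V) [DiscreteTopology Γ] [IsZLattice ℝ Γ]

/-- **The Gaussian sum over a shifted lattice converges**: `∑_{x ∈ Γ} e^{-πt‖x+u‖²} < ∞` for
`t > 0` (rapid decay is summable over lattices,
`Literature.NumberTheory.LFunctions.Fourier.summable_of_decay_zlattice`). [folklore] -/
theorem summable_exp_neg_pi_mul_norm_add_sq {t : ℝ} (ht : 0 < t) (u : V) :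
    Summable fun x : Γ => Real.exp (-π * t * ‖(x : V) + u‖ ^ 2) := by
  set b : ℝ := Module.finrank ℝ V + 1 with hbdef
  have hb : (Module.finrank ℝ V : ℝ) < b := by rw [hbdef]; linarith
  have hb0 : 0 ≤ b := by rw [hbdef]; positivity
  have h := Literature.NumberTheory.LFunctions.Fourier.summable_of_decay_zlattice Γ hb
    (g := fun x : V => ((Real.exp (-π * t * ‖x + u‖ ^ 2) : ℝ) : ℂ))
    (C := Real.exp (b ^ 2 / (4 * (π * t))) * (1 + ‖u‖) ^ b) (fun x => by
      rw [norm_real, Real.norm_eq_abs, abs_of_pos (Real.exp_pos _)]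
      exact exp_neg_pi_mul_norm_add_sq_le ht hb0 u x)
  exact (summable_ofReal (f := fun x : Γ => Real.exp (-π * t * ‖(x : V) + u‖ ^ 2))).mp h

/-- **Absolute convergence of the theta series** `Θ_{Γ+u}(τ) = ∑_{x ∈ Γ} e^{πiτ‖x+u‖²}` for
`Im τ > 0` (Conway–Sloane 1999, Ch. 2 §2.3: `Θ_Λ(z)` "is a holomorphic function of `z` for
`Im(z) > 0`"). [cite: ConwaySloane1999, Ch. 2 §2.3 (31)] -/
theorem summable_cexp_pi_I_mul_norm_add_sq {τ : ℂ} (hτ : 0 < τ.im) (u : V) :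
    Summable fun x : Γ => cexp ((π : ℂ) * I * τ * ((‖(x : V) + u‖ ^ 2 : ℝ) : ℂ)) :=
  Summable.of_norm_bounded (summable_exp_neg_pi_mul_norm_add_sq Γ hτ u) fun _ =>
    norm_cexp_pi_I_mul_le le_rfl (sq_nonneg _)

/-- The norm of the theta series is at most the Gaussian sum at `t ≤ Im τ`:
`|Θ_{Γ+u}(τ)| ≤ ∑_{x ∈ Γ} e^{-πt‖x+u‖²}`. [folklore] -/
theorem norm_tsum_cexp_pi_I_mul_norm_add_sq_le_tsum {τ : ℂ} {t : ℝ} (ht : 0 < t) (htτ : t ≤ τ.im)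
    (u : V) :
    ‖∑' x : Γ, cexp ((π : ℂ) * I * τ * ((‖(x : V) + u‖ ^ 2 : ℝ) : ℂ))‖ ≤
      ∑' x : Γ, Real.exp (-π * t * ‖(x : V) + u‖ ^ 2) :=
  tsum_of_norm_bounded (summable_exp_neg_pi_mul_norm_add_sq Γ ht u).hasSum fun _ =>
    norm_cexp_pi_I_mul_le htτ (sq_nonneg _)

/-- **Size at `i∞` from the minimal norm of the coset** (Elkies 1995: `Θ_{L+w/2}` is
`O(|q|^{m/4})` with `m` the minimal characteristic norm): if `‖x + u‖² ≥ m` for all `x ∈ Γ` and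
`Im τ ≥ 1`, then `|Θ_{Γ+u}(τ)| ≤ e^{-π (Im τ - 1) m} ∑_{x ∈ Γ} e^{-π‖x+u‖²}`.
[cite: Elkies1995, proof of the Theorem] -/
theorem norm_tsum_cexp_pi_I_mul_norm_add_sq_le {τ : ℂ} (hτ : 1 ≤ τ.im) (u : V) {m : ℝ}
    (hm : ∀ x : Γ, m ≤ ‖(x : V) + u‖ ^ 2) :
    ‖∑' x : Γ, cexp ((π : ℂ) * I * τ * ((‖(x : V) + u‖ ^ 2 : ℝ) : ℂ))‖ ≤
      Real.exp (-π * (τ.im - 1) * m) * ∑' x : Γ, Real.exp (-π * ‖(x : V) + u‖ ^ 2) := by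
  have h1 := summable_exp_neg_pi_mul_norm_add_sq Γ one_pos u
  simp only [mul_one] at h1
  rw [← tsum_mul_left]
  refine tsum_of_norm_bounded (h1.mul_left _).hasSum fun x => ?_
  rw [norm_cexp_pi_I_mul, ← Real.exp_add, Real.exp_le_exp]
  have hx := hm x
  have hπ := Real.pi_pos
  nlinarith [mul_nonneg (mul_nonneg hπ.le (sub_nonneg.mpr hτ)) (sub_nonneg.mpr hx)]

/-- **Holomorphy of the theta series** on the upper half plane (Conway–Sloane 1999, Ch. 2 §2.3:
`Θ_Λ(z)` "is a holomorphic function of `z` for `Im(z) > 0`"): locally uniform convergence on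
`Im τ > t > 0` (Weierstrass M-test with the majorant `e^{-πt‖x+u‖²}`).
[cite: ConwaySloane1999, Ch. 2 §2.3 (31)] -/
theorem differentiableOn_tsum_cexp_pi_I_mul_norm_add_sq (u : V) :
    DifferentiableOn ℂ
      (fun τ : ℂ => ∑' x : Γ, cexp ((π : ℂ) * I * τ * ((‖(x : V) + u‖ ^ 2 : ℝ) : ℂ)))
      {τ : ℂ | 0 < τ.im} := by
  intro τ hτ
  have hτ : 0 < τ.im := hτ
  -- work on the open half plane `Im > Im τ / 2`, where the majorant is uniform
  set t : ℝ := τ.im / 2 with htdef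
  have ht : 0 < t := by rw [htdef]; linarith
  have hopen : IsOpen {σ : ℂ | t < σ.im} := isOpen_lt continuous_const Complex.continuous_im
  have hdiff : DifferentiableOn ℂ
      (fun σ : ℂ => ∑' x : Γ, cexp ((π : ℂ) * I * σ * ((‖(x : V) + u‖ ^ 2 : ℝ) : ℂ)))
      {σ : ℂ | t < σ.im} := by
    refine differentiableOn_tsum_of_summable_norm (summable_exp_neg_pi_mul_norm_add_sq Γ ht u)
      (fun x => ?_) hopen (fun x σ hσ => norm_cexp_pi_I_mul_le (le_of_lt hσ) (sq_nonneg _))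
    fun_prop
  have hmem : τ ∈ {σ : ℂ | t < σ.im} := by show t < τ.im; rw [htdef]; linarith
  exact ((hdiff τ hmem).differentiableAt (hopen.mem_nhds hmem)).differentiableWithinAt

/-- Continuity of the theta series on the upper half plane. [folklore] -/
theorem continuousOn_tsum_cexp_pi_I_mul_norm_add_sq (u : V) :
    ContinuousOn (fun τ : ℂ => ∑' x : Γ, cexp ((π : ℂ) * I * τ * ((‖(x : V) + u‖ ^ 2 : ℝ) : ℂ)))
      {τ : ℂ | 0 < τ.im} :=
  (differentiableOn_tsum_cexp_pi_I_mul_norm_add_sq Γ u).continuousOn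

/-- **`Θ_Γ(τ) → 1` as `Im τ → ∞`**: the term `x = 0` is `1` and every other term tends to `0`
(`‖x‖ > 0`), dominated by `e^{-π‖x‖²}` for `Im τ ≥ 1` (Conway–Sloane 1999, Ch. 2 §2.3 (32):
`Θ_Λ(z) = ∑_m N_m q^m` with `N_0 = 1`). [cite: ConwaySloane1999, Ch. 2 §2.3 (32)] -/
theorem tendsto_tsum_cexp_pi_I_mul_norm_sq :
    Tendsto (fun τ : ℂ => ∑' x : Γ, cexp ((π : ℂ) * I * τ * ((‖(x : V)‖ ^ 2 : ℝ) : ℂ)))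
      (comap Complex.im atTop) (𝓝 1) := by
  classical
  have hlim : (1 : ℂ) = ∑' x : Γ, if x = 0 then (1 : ℂ) else 0 := by rw [tsum_ite_eq]
  rw [hlim]
  have hb := summable_exp_neg_pi_mul_norm_add_sq Γ one_pos (0 : V)
  simp only [mul_one, add_zero] at hb
  refine tendsto_tsum_of_dominated_convergence hb (fun x => ?_) ?_
  · by_cases hx : x = 0
    · subst hx
      simp only [Submodule.coe_zero, norm_zero, if_true]
      refine tendsto_const_nhds.congr fun τ => ?_
      simp
    · simp only [hx, if_false]
      rw [tendsto_zero_iff_norm_tendsto_zero]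
      have hpos : 0 < ‖(x : V)‖ ^ 2 := by
        have : (x : V) ≠ 0 := fun h => hx (Subtype.ext h)
        positivity
      have h1 : Tendsto (fun τ : ℂ => -π * τ.im * ‖(x : V)‖ ^ 2) (comap Complex.im atTop)
          atBot := by
        have hc : Tendsto (fun τ : ℂ => τ.im) (comap Complex.im atTop) atTop := tendsto_comap
        have : Tendsto (fun τ : ℂ => τ.im * (π * ‖(x : V)‖ ^ 2)) (comap Complex.im atTop) atTop :=
          hc.atTop_mul_const (mul_pos Real.pi_pos hpos)
        refine (tendsto_neg_atTop_atBot.comp this).congr fun τ => ?_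
        simp only [Function.comp_apply]; ring
      refine (Real.tendsto_exp_atBot.comp h1).congr fun τ => ?_
      rw [Function.comp_apply, norm_cexp_pi_I_mul]
  · filter_upwards [preimage_mem_comap (Ici_mem_atTop (1 : ℝ))] with τ hτ x
    have hτ : 1 ≤ τ.im := hτ
    exact (norm_cexp_pi_I_mul_le hτ (sq_nonneg _)).trans (le_of_eq (by rw [mul_one]))

omit [InnerProductSpace ℝ V] [FiniteDimensional ℝ V] [DiscreteTopology Γ] [IsZLattice ℝ Γ] in
/-- **`Θ_Γ(τ + 2) = Θ_Γ(τ)` for an integral lattice** (all `‖x‖² ∈ ℤ`): `e^{2πi‖x‖²} = 1`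
(Conway–Sloane 1999, Ch. 2 §2.4 and Ch. 7: the theta series of an integral lattice is a modular
form for a subgroup containing `z ↦ z + 2`). [cite: ConwaySloane1999, Ch. 2 §2.4] -/
theorem tsum_cexp_pi_I_mul_norm_sq_add_two (hint : ∀ x : Γ, ∃ k : ℤ, ‖(x : V)‖ ^ 2 = k) (τ : ℂ) :
    ∑' x : Γ, cexp ((π : ℂ) * I * (τ + 2) * ((‖(x : V)‖ ^ 2 : ℝ) : ℂ)) =
      ∑' x : Γ, cexp ((π : ℂ) * I * τ * ((‖(x : V)‖ ^ 2 : ℝ) : ℂ)) := by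
  refine tsum_congr fun x => ?_
  obtain ⟨k, hk⟩ := hint x
  rw [hk, show (π : ℂ) * I * (τ + 2) * ((k : ℝ) : ℂ) =
      π * I * τ * ((k : ℝ) : ℂ) + k * (2 * π * I) by push_cast; ring, Complex.exp_add,
    Complex.exp_int_mul_two_pi_mul_I, mul_one]

/-- **`Θ_Γ(τ + 1)` for an integral lattice**: `e^{πi(τ+1)‖x‖²} = (-1)^{‖x‖²} e^{πiτ‖x‖²}`, so
`Θ_Γ(τ + 1) = ∑_{x ∈ Γ} (-1)^{‖x‖²} e^{πiτ‖x‖²}` (Conway–Sloane 1999, Ch. 7 §… ; for `Γ = ℤ`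
this is `θ₃(z + 1) = θ₄(z)`). Termwise form. [cite: ConwaySloane1999, Ch. 4 §4.1] -/
theorem cexp_pi_I_add_one_mul_intCast (τ : ℂ) (k : ℤ) :
    cexp ((π : ℂ) * I * (τ + 1) * (k : ℂ)) = (-1) ^ k * cexp ((π : ℂ) * I * τ * (k : ℂ)) := by
  rw [show (π : ℂ) * I * (τ + 1) * (k : ℂ) = k * (π * I) + π * I * τ * (k : ℂ) by ring,
    Complex.exp_add]
  congr 1
  rw [Complex.exp_int_mul, Complex.exp_pi_mul_I]

end Lattice

/-! ### The theta inversion formula (Poisson summation) -/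

section Inversion

variable {V : Type*} [NormedAddCommGroup V] [InnerProductSpace ℝ V] [FiniteDimensional ℝ V]
  [MeasurableSpace V] [BorelSpace V]

open scoped FourierTransform RealInnerProductSpace
open MeasureTheory

/-- `Im(-1/τ) = Im τ / |τ|² > 0` for `Im τ > 0`. [folklore] -/
theorem neg_inv_im_pos {τ : ℂ} (hτ : 0 < τ.im) : 0 < (-τ⁻¹).im := by
  rw [neg_im, inv_im, neg_div, neg_neg]
  exact div_pos hτ (normSq_pos.mpr fun h => by rw [h, zero_im] at hτ; exact lt_irrefl _ hτ)

/-- The algebra of the Gaussian constant: with `b = -πiτ`, `π / b = i / τ`. [folklore] -/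
theorem pi_div_neg_pi_I_mul {τ : ℂ} (hτ : τ ≠ 0) : (π : ℂ) / (-π * I * τ) = I / τ := by
  have hπ : (π : ℂ) ≠ 0 := ofReal_ne_zero.mpr Real.pi_ne_zero
  rw [div_eq_div_iff (mul_ne_zero (mul_ne_zero (neg_ne_zero.mpr hπ) I_ne_zero) hτ) hτ]
  linear_combination (π * τ : ℂ) * I_sq

/-- The algebra of the Gaussian exponent: with `b = -πiτ`, `-π² r / b = -πi r / τ`. [folklore] -/
theorem neg_pi_sq_mul_div_neg_pi_I_mul {τ : ℂ} (hτ : τ ≠ 0) (r : ℂ) :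
    -(π : ℂ) ^ 2 * r / (-π * I * τ) = -π * I * r / τ := by
  have hπ : (π : ℂ) ≠ 0 := ofReal_ne_zero.mpr Real.pi_ne_zero
  rw [div_eq_div_iff (mul_ne_zero (mul_ne_zero (neg_ne_zero.mpr hπ) I_ne_zero) hτ) hτ]
  linear_combination (-(π : ℂ) ^ 2 * r * τ) * I_sq

/-- **Fourier transform of the shifted complex Gaussian**: for `Im τ > 0` and `u ∈ V`,
`𝓕[v ↦ e^{πiτ‖v+u‖²}](w) = e^{2πi⟨u,w⟩} (i/τ)^{n/2} e^{-πi‖w‖²/τ}`, `n = dim V`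
(Mathlib's `fourier_gaussian_innerProductSpace` with `b = -πiτ`, and translation by `u` becomes the
phase `e^{2πi⟨u,w⟩}`, `VectorFourier.fourierIntegral_comp_add_right`). The power is the principal
branch `Complex.cpow`. [folklore] -/
theorem fourier_cexp_pi_I_mul_norm_add_sq {τ : ℂ} (hτ : 0 < τ.im) (u w : V) :
    𝓕 (fun v : V => cexp ((π : ℂ) * I * τ * ((‖v + u‖ ^ 2 : ℝ) : ℂ))) w =
      cexp (2 * π * I * (⟪u, w⟫ : ℝ)) * ((I / τ) ^ ((Module.finrank ℝ V : ℂ) / 2) *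
        cexp (-π * I * ((‖w‖ ^ 2 : ℝ) : ℂ) / τ)) := by
  have hτ0 : τ ≠ 0 := fun h => by rw [h, zero_im] at hτ; exact lt_irrefl _ hτ
  set b : ℂ := -π * I * τ with hbdef
  have hb : 0 < b.re := by
    rw [hbdef]
    simp only [neg_mul, neg_re, mul_re, ofReal_re, I_re, mul_zero, ofReal_im, I_im, mul_one,
      zero_sub, mul_im]
    ring_nf
    positivity
  have hfun : (fun v : V => cexp ((π : ℂ) * I * τ * ((‖v + u‖ ^ 2 : ℝ) : ℂ))) =
      (fun v : V => cexp (-b * (‖v‖ : ℂ) ^ 2)) ∘ fun v => v + u := by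
    funext v
    simp only [Function.comp_apply, hbdef]
    congr 1
    push_cast
    ring
  rw [hfun]
  change VectorFourier.fourierIntegral 𝐞 volume (innerₗ V) _ w = _
  rw [VectorFourier.fourierIntegral_comp_add_right]
  change ((𝐞 (innerₗ V u w) : ℂ)) • 𝓕 (fun v : V => cexp (-b * (‖v‖ : ℂ) ^ 2)) w = _
  rw [fourier_gaussian_innerProductSpace hb w, innerₗ_apply_apply, Real.fourierChar_apply,
    smul_eq_mul, hbdef, pi_div_neg_pi_I_mul hτ0]
  congr 1
  · congr 1
    push_cast
    ring
  · congr 1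
    rw [← neg_pi_sq_mul_div_neg_pi_I_mul hτ0]
    push_cast
    ring

variable (Γ : Submodule ℤ V) [DiscreteTopology Γ] [IsZLattice ℝ Γ]

omit [MeasurableSpace V] [BorelSpace V] in
/-- Summability of the dual side of the inversion formula:
`∑_{y ∈ Γ*} e^{2πi⟨u,y⟩} e^{-πi‖y‖²/τ}` converges absolutely for `Im τ > 0` (the phases have
modulus `1` and `Im(-1/τ) > 0`). [folklore] -/
theorem summable_cexp_inner_mul_cexp_neg {τ : ℂ} (hτ : 0 < τ.im) (u : V) :
    Summable fun y : dualLattice Γ =>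
      cexp (2 * π * I * (⟪u, (y : V)⟫ : ℝ)) * cexp (-π * I * ((‖(y : V)‖ ^ 2 : ℝ) : ℂ) / τ) := by
  have hS := (summable_cexp_pi_I_mul_norm_add_sq (dualLattice Γ) (neg_inv_im_pos hτ) (0 : V)).norm
  refine Summable.of_norm_bounded hS fun y => ?_
  rw [norm_mul, show 2 * (π : ℂ) * I * ((⟪u, (y : V)⟫ : ℝ) : ℂ) =
      ((2 * π * ⟪u, (y : V)⟫ : ℝ) : ℂ) * I by push_cast; ring, norm_exp_ofReal_mul_I, one_mul,
    add_zero]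
  refine le_of_eq ?_
  congr 2
  field_simp

/-- **The theta inversion formula with a shift** (Poisson summation): for a full lattice `Γ ⊂ V`,
`dim V = n`, `u ∈ V` and `Im τ > 0`,
`∑_{x ∈ Γ} e^{πiτ‖x+u‖²} = vol(V/Γ)⁻¹ (i/τ)^{n/2} ∑_{y ∈ Γ*} e^{2πi⟨u,y⟩} e^{-πi‖y‖²/τ}`
(Conway–Sloane 1999, Ch. 4 §4.1 (14), (19): Jacobi's imaginary transformation with a shift and
"Jacobi's formula for the theta series of the dual lattice", both "consequences of the general
version of the Poisson summation formula"; Serre,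
*A Course in Arithmetic*, Ch. VII §6 Prop. 16 for `u = 0`; Elkies 1995, the transformation of
`θ_L` under `z ↦ -1/z` with the shift by half a characteristic vector). From the tree's Poisson
summation formula in decay form
(`Literature.NumberTheory.LFunctions.Fourier.tsum_eq_tsum_fourier_of_rpow_decay`) and
`fourier_cexp_pi_I_mul_norm_add_sq`. [cite: ConwaySloane1999, Ch. 4 §4.1 (14), (19)] -/
theorem tsum_cexp_pi_I_mul_norm_add_sq_eq {τ : ℂ} (hτ : 0 < τ.im) (u : V) :
    ∑' x : Γ, cexp ((π : ℂ) * I * τ * ((‖(x : V) + u‖ ^ 2 : ℝ) : ℂ)) =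
      ((ZLattice.covolume Γ)⁻¹ : ℝ) • ((I / τ) ^ ((Module.finrank ℝ V : ℂ) / 2) *
        ∑' y : dualLattice Γ,
          cexp (2 * π * I * (⟪u, (y : V)⟫ : ℝ)) *
            cexp (-π * I * ((‖(y : V)‖ ^ 2 : ℝ) : ℂ) / τ)) := by
  set b : ℝ := Module.finrank ℝ V + 1 with hbdef
  have hb : (Module.finrank ℝ V : ℝ) < b := by rw [hbdef]; linarith
  have hb0 : 0 ≤ b := by rw [hbdef]; positivity
  have hcont : Continuous fun v : V => cexp ((π : ℂ) * I * τ * ((‖v + u‖ ^ 2 : ℝ) : ℂ)) := by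
    fun_prop
  have hdec := fun x : V => norm_cexp_pi_I_mul_norm_add_sq_le (τ := τ) hτ le_rfl hb0 u x
  have hF : ∀ y : dualLattice Γ,
      𝓕 (fun v : V => cexp ((π : ℂ) * I * τ * ((‖v + u‖ ^ 2 : ℝ) : ℂ))) y =
        (I / τ) ^ ((Module.finrank ℝ V : ℂ) / 2) *
          (cexp (2 * π * I * (⟪u, (y : V)⟫ : ℝ)) *
            cexp (-π * I * ((‖(y : V)‖ ^ 2 : ℝ) : ℂ) / τ)) := fun y => by
    rw [fourier_cexp_pi_I_mul_norm_add_sq hτ u y]; ring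
  have hsum : Summable fun y : dualLattice Γ =>
      𝓕 (fun v : V => cexp ((π : ℂ) * I * τ * ((‖v + u‖ ^ 2 : ℝ) : ℂ))) y := by
    simp_rw [hF]
    exact (summable_cexp_inner_mul_cexp_neg Γ hτ u).mul_left _
  rw [Literature.NumberTheory.LFunctions.Fourier.tsum_eq_tsum_fourier_of_rpow_decay Γ hcont hb
    hdec hsum]
  congr 1
  simp_rw [hF]
  exact tsum_mul_left

/-- **The theta inversion formula** `Θ_Γ(τ) = vol(V/Γ)⁻¹ (i/τ)^{n/2} Θ_{Γ*}(-1/τ)` (the case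
`u = 0`; Serre, *A Course in Arithmetic*, Ch. VII §6 Prop. 16; Conway–Sloane 1999, Ch. 4 §4.1
(19), "Jacobi's formula for the theta series of the dual lattice"
`Θ_{Λ*}(z) = (det Λ)^{1/2} (i/z)^{n/2} Θ_Λ(-1/z)`, applied to `Λ = Γ*`, `det Γ* = vol(V/Γ)⁻²`).
[cite: ConwaySloane1999, Ch. 4 §4.1 (19)] -/
theorem tsum_cexp_pi_I_mul_norm_sq_eq {τ : ℂ} (hτ : 0 < τ.im) :
    ∑' x : Γ, cexp ((π : ℂ) * I * τ * ((‖(x : V)‖ ^ 2 : ℝ) : ℂ)) =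
      ((ZLattice.covolume Γ)⁻¹ : ℝ) • ((I / τ) ^ ((Module.finrank ℝ V : ℂ) / 2) *
        ∑' y : dualLattice Γ, cexp ((π : ℂ) * I * (-τ⁻¹) * ((‖(y : V)‖ ^ 2 : ℝ) : ℂ))) := by
  have h := tsum_cexp_pi_I_mul_norm_add_sq_eq Γ hτ 0
  simp only [add_zero, inner_zero_left, ofReal_zero, mul_zero, Complex.exp_zero, one_mul] at h
  rw [h]
  congr 3
  funext y
  congr 1
  field_simp

end Inversion

end Literature.Algebra.EuclideanLattices

end
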